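import Summits.CriticalPhenomena.PercolationContinuityZ3.Theorems.PercNearOneGluingNoHeavyLowerTailThreePointProductFormCornersCert1
import Summits.CriticalPhenomena.PercolationContinuityZ3.Theorems.PercNearOneGluingNoHeavyLowerTailThreePointProductFormCornersCert2
import Summits.CriticalPhenomena.PercolationContinuityZ3.Theorems.PercNearOneGluingNoHeavyLowerTailThreePointProductFormCornersCert3
import Summits.CriticalPhenomena.PercolationContinuityZ3.Theorems.PercNearOneGluingNoHeavyLowerTailThreePointProductFormCornersCert4
import Summits.CriticalPhenomena.PercolationContinuityZ3.Theorems.PercNearOneGluingNoHeavyLowerTailThreePointProductFormCornersCert5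
import Summits.CriticalPhenomena.PercolationContinuityZ3.Theorems.PercNearOneGluingNoHeavyLowerTailThreePointProductFormCornersCert6
import Summits.CriticalPhenomena.PercolationContinuityZ3.Theorems.PercNearOneGluingNoHeavyLowerTailThreePointProductFormCornersCert7
import Summits.CriticalPhenomena.PercolationContinuityZ3.Theorems.PercNearOneGluingNoHeavyLowerTailThreePointProductFormCornersCert8
import Summits.CriticalPhenomena.PercolationContinuityZ3.Theorems.PercNearOneGluingNoHeavyLowerTailThreePointProductFormCornersSmall

/-!
# THEOREM C (assembly): the AM form is nonnegative at EVERY corner of the physical box, for EVERY cycle length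
# (Sahi programme, prover prim-sahi-p2 gen 65)

Support file (`--supports stmt-CriticalPhenomena-4575`).  Standard axioms, no sorries.  Memo
`run/shared/lean/prim/prim-sahi/FROM-prim-sahi-p2-gen65-CORNER-THEOREM.md`, `prim-sahi-p2/PROOF-E3.md` §75.

`corner_nonneg : ∀ w : List Bool, 0 ≤ tval w` — for the explicit trace form `tval` of `…ThreePointProductFormCorners`
(`= tr(N_w Ω) + 8 − 2|w|` on the 3-dimensional module of the AM-form series; by the exact trace identity of the memo this is the corner
value `α M_{w₁}⋯M_{w_k} ω = #P1 + #P2 − 2·#bad` of the cycle `a–y₁–…–y_k–a` through the apex whose vertex `y_t` carries a pendant edge to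
`s` (`w_t = true`) or to `c` (`w_t = false`)).  So `2·#bad ≤ #P1 + #P2` for every such graph, every length, every sign pattern — the first
all-`k` instance of (★) with genuinely MIXED leaning.  Proof: words of length `≤ 7` by `tval_small`; longer words `w' ++ u` (`|u| = 7`) by the
64 suffix certificates `cert7` (after the global flip `tval_map_not` if `u₁ = false`): `tval (w' ++ u) ≥ (1283/400)·3^{|w'|} + 8 − 2(|w'|+7) ≥ 0`.
[this work] (gen 65).
-/

namespace Summit.CriticalPhenomena.PercolationContinuityZ3.Theorems.ProductFormCorners

/-- The word action is multiplicative: `N_{w ++ u} = N_w ∘ N_u`. [this work] -/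
theorem iter_append (w u : List Bool) (v : V3) : iter (w ++ u) v = iter w (iter u v) := by
  induction w with
  | nil => rfl
  | cons b w ih => simp [iter, ih]

/-- Dispatcher over the 64 suffix words of length 7 with first letter `+`. [this work] -/
theorem cert7 (b2 b3 b4 b5 b6 b7 : Bool) (w : List Bool) :
    (1283/400 : ℚ) * 3 ^ w.length ≤
      dot om1 (iter w (iter [true, b2, b3, b4, b5, b6, b7] e1)) + dot om2 (iter w (iter [true, b2, b3, b4, b5, b6, b7] e2))
        + dot om3 (iter w (iter [true, b2, b3, b4, b5, b6, b7] e3)) := by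
  cases b2 <;> cases b3 <;> cases b4 <;> cases b5 <;> cases b6 <;> cases b7
  · exact cert_tffffff w
  · exact cert_tffffft w
  · exact cert_tfffftf w
  · exact cert_tfffftt w
  · exact cert_tffftff w
  · exact cert_tffftft w
  · exact cert_tfffttf w
  · exact cert_tfffttt w
  · exact cert_tfftfff w
  · exact cert_tfftfft w
  · exact cert_tfftftf w
  · exact cert_tfftftt w
  · exact cert_tffttff w
  · exact cert_tffttft w
  · exact cert_tfftttf w
  · exact cert_tfftttt w
  · exact cert_tftffff w
  · exact cert_tftffft w
  · exact cert_tftfftf w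
  · exact cert_tftfftt w
  · exact cert_tftftff w
  · exact cert_tftftft w
  · exact cert_tftfttf w
  · exact cert_tftfttt w
  · exact cert_tfttfff w
  · exact cert_tfttfft w
  · exact cert_tfttftf w
  · exact cert_tfttftt w
  · exact cert_tftttff w
  · exact cert_tftttft w
  · exact cert_tfttttf w
  · exact cert_tfttttt w
  · exact cert_ttfffff w
  · exact cert_ttfffft w
  · exact cert_ttffftf w
  · exact cert_ttffftt w
  · exact cert_ttfftff w
  · exact cert_ttfftft w
  · exact cert_ttffttf w
  · exact cert_ttffttt w
  · exact cert_ttftfff w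
  · exact cert_ttftfft w
  · exact cert_ttftftf w
  · exact cert_ttftftt w
  · exact cert_ttfttff w
  · exact cert_ttfttft w
  · exact cert_ttftttf w
  · exact cert_ttftttt w
  · exact cert_tttffff w
  · exact cert_tttffft w
  · exact cert_tttfftf w
  · exact cert_tttfftt w
  · exact cert_tttftff w
  · exact cert_tttftft w
  · exact cert_tttfttf w
  · exact cert_tttfttt w
  · exact cert_ttttfff w
  · exact cert_ttttfft w
  · exact cert_ttttftf w
  · exact cert_ttttftt w
  · exact cert_tttttff w
  · exact cert_tttttft w
  · exact cert_ttttttf w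
  · exact cert_ttttttt w

/-- The elementary growth estimate `2(n+7) ≤ (1283/400)·3^n + 8` for `n ≥ 1`. [this work] -/
theorem growth_arith (n : ℕ) (hn : 1 ≤ n) : 2 * ((n : ℚ) + 7) ≤ (1283/400 : ℚ) * 3 ^ n + 8 := by
  induction n, hn using Nat.le_induction with
  | base => norm_num
  | succ m hm ih =>
    rw [pow_succ]
    push_cast at ih ⊢
    have h3 : (1 : ℚ) ≤ 3 ^ m := one_le_pow₀ (by norm_num)
    nlinarith [ih, h3]

/-- A word `w' ++ u` with `|u| = 7`, `u₁ = +` and `|w'| ≥ 1` has `tval ≥ 0`. [this work] -/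
theorem tval_append_true (w : List Bool) (b2 b3 b4 b5 b6 b7 : Bool) (hw : 1 ≤ w.length) :
    0 ≤ tval (w ++ [true, b2, b3, b4, b5, b6, b7]) := by
  have hc := cert7 b2 b3 b4 b5 b6 b7 w
  have hg := growth_arith w.length hw
  unfold tval
  rw [iter_append, iter_append, iter_append, List.length_append]
  push_cast
  simp only [List.length_cons, List.length_nil]
  push_cast
  linarith

/-- A word `w' ++ u` with `|u| = 7` and `|w'| ≥ 1` has `tval ≥ 0` (flip to `u₁ = +` by `tval_map_not`). [this work] -/
theorem tval_append_nonneg (w u : List Bool) (hw : 1 ≤ w.length) (hu : u.length = 7) : 0 ≤ tval (w ++ u) := by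
  rcases u with _ | ⟨b1, u⟩
  · simp at hu
  rcases u with _ | ⟨b2, u⟩
  · simp at hu
  rcases u with _ | ⟨b3, u⟩
  · simp at hu
  rcases u with _ | ⟨b4, u⟩
  · simp at hu
  rcases u with _ | ⟨b5, u⟩
  · simp at hu
  rcases u with _ | ⟨b6, u⟩
  · simp at hu
  rcases u with _ | ⟨b7, u⟩
  · simp at hu
  rcases u with _ | ⟨b8, u⟩
  swap
  · simp at hu
  cases b1
  · -- flip the whole word
    rw [← tval_map_not]
    rw [List.map_append]
    simp only [List.map, Bool.not_false]
    exact tval_append_true (w.map (fun b => !b)) (!b2) (!b3) (!b4) (!b5) (!b6) (!b7) (by simpa using hw)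
  · exact tval_append_true w b2 b3 b4 b5 b6 b7 hw

/-- ★ THEOREM C.  For every sign pattern `w : List Bool` (every cycle length, every assignment of the pendant edges to `s`/`c`):
`0 ≤ tval w`, i.e. `2·#bad ≤ #P1 + #P2` at every corner of the physical box (memo §0(1); trace identity §0(2c)). [this work] -/
theorem corner_nonneg (w : List Bool) : 0 ≤ tval w := by
  by_cases h : w.length ≤ 7
  · exact tval_small w h
  · rw [not_le] at h
    have hsplit := List.take_append_drop (w.length - 7) w
    rw [← hsplit]
    apply tval_append_nonneg
    · simp only [List.length_take]; omega
    · simp only [List.length_drop]; omega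

/-! ### Quantitative rate (referee F297-1): the landed `m₀ = 7`, `γ = 1/80` certificates give the bound
`tval w ≥ (1283/400)·3^(|w|−7) + 8 − 2|w|` for `|w| ≥ 7` (the memo's `(1283/125)·3^(|w|−8)` is the stronger `m₀ = 8` family,
not formalised).  [this work] (gen 66) -/

/-- Rate form of the suffix certificate: for every `w` and `u = (+, b₂, …, b₇)`:
`tval (w ++ u) ≥ (1283/400)·3^{|w|} + 8 − 2(|w| + 7)`. [this work] -/
theorem tval_append_true_rate (w : List Bool) (b2 b3 b4 b5 b6 b7 : Bool) :
    (1283/400 : ℚ) * 3 ^ w.length + 8 - 2 * ((w.length : ℚ) + 7) ≤ tval (w ++ [true, b2, b3, b4, b5, b6, b7]) := by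
  have hc := cert7 b2 b3 b4 b5 b6 b7 w
  unfold tval
  rw [iter_append, iter_append, iter_append, List.length_append]
  push_cast
  simp only [List.length_cons, List.length_nil]
  push_cast
  linarith

/-- ★ THEOREM C with rate: every word `w ++ u` with `|u| = 7` satisfies `tval (w ++ u) ≥ (1283/400)·3^{|w|} + 8 − 2(|w|+7)`,
i.e. `tval v ≥ (1283/400)·3^(|v|−7) + 8 − 2|v|` for every sign pattern `v` of length `≥ 7` (flip to `u₁ = +` by `tval_map_not`). [this work] -/
theorem tval_rate (w u : List Bool) (hu : u.length = 7) :
    (1283/400 : ℚ) * 3 ^ w.length + 8 - 2 * ((w.length : ℚ) + 7) ≤ tval (w ++ u) := by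
  rcases u with _ | ⟨b1, u⟩
  · simp at hu
  rcases u with _ | ⟨b2, u⟩
  · simp at hu
  rcases u with _ | ⟨b3, u⟩
  · simp at hu
  rcases u with _ | ⟨b4, u⟩
  · simp at hu
  rcases u with _ | ⟨b5, u⟩
  · simp at hu
  rcases u with _ | ⟨b6, u⟩
  · simp at hu
  rcases u with _ | ⟨b7, u⟩
  · simp at hu
  rcases u with _ | ⟨b8, u⟩
  swap
  · simp at hu
  cases b1
  · rw [← tval_map_not]
    rw [List.map_append]
    simp only [List.map, Bool.not_false]
    have h := tval_append_true_rate (w.map (fun b => !b)) (!b2) (!b3) (!b4) (!b5) (!b6) (!b7)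
    simpa using h
  · exact tval_append_true_rate w b2 b3 b4 b5 b6 b7

end Summit.CriticalPhenomena.PercolationContinuityZ3.Theorems.ProductFormCorners
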